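/-
Copyright (c) 2026. All rights reserved.
Released under Apache 2.0 license as described in the file LICENSE.
Authors: abc-iut cell, prover seat abc-iut-w5-d039 (wave 5, gen 7).
-/
import Literature.IUT.LogVolume.UnitLogVolume
import HarnessLib

/-!
# Which balls are `p^k · log_p(𝒪_K^×)`?  The volume constraint `m = f·(j − ke − 1)` and the torsion-free case

Proof-only companion (theorems, no definitions) of the campaign-S volume files `UnitLogVolume.lean`
(abc-iut-S8: `μ_K(log_p(𝒪_K^×)) = p^{−(f+m)}`, [IUTchIV] Prop. 1.4 (ii)), `LocalFieldVolume.lean`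
(abc-iut-S2: `μ_K(𝔪_K^n) = q^{−n}`) and `TorsionUnits.lean` (abc-iut-S1: `#R^μ = p^m·(p^f − 1)`), written for
the abc-iut cell's TEAM R «ismDH ball-mover» thread (abc-iut-w5-d216 / w5-d180 / w5-d039): by abc-iut-w5-d180's
BALL-MOVER CRITERION (`Summits/ABC/IUTFork/Thm311RealIsmDHMoverCriterion.lean`) a ball `t·𝒪_v` of the completion
`K = F_v` is fixed by EVERY element of Dupuy–Hilado's (Ind2) group iff `t·𝒪_v = p^k · log_p(𝒪_v^×)` for some
`k ∈ ℤ`; that file evaluates the condition at TAME places (`e ≤ p − 2`, where `log_p(𝒪^×) = 𝔪`) and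
`UnitLogUnramifiedDyadic.lean` at `e = 1`, `p = 2`, `f ≥ 2`; abc-iut-w5-d044's `LogUnitsHomothetyVolumeCriterion.lean`
(p437168, landed while this file was being written) gives the VOLUME TEST for the unit ball in the form
`𝒪_K = p^k · log_p(𝒪_K^×) ⇒ #R^μ · q = q^{−e·k} · (q − 1)`.  THIS FILE (independent proofs, through abc-iut-S8's
packaged value `μ_K(log_p(𝒪_K^×)) = p^{−(f+m)}`) gives the constraint in CLOSED FORM in `(e, f, m)`, for balls of ANY
radius `‖ϖ‖^j`, EVALUATES it in the torsion-free case, and supplies the arithmetic criterion `(p − 1) ∤ e ⇒ m = 0`: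

* `torsionPExp_eq_of_closedBall_eq_zpow_smul_logUnits`: for a norm uniformizer `ϖ`, if
  `{‖y‖ ≤ ‖ϖ‖^j} = p^k · log_p(𝒪_K^×)` then **`m = f · (j − k·e − 1)`**, where `e = absRamificationIdx p K`,
  `f = residueDegree p K` and `p^m` (`m = torsionPExp p K`) is the order of the `p`-primary torsion of `𝒪_K^×`
  (`μ_K` of the left side is `q^{−j} = p^{−fj}`, of the right side `‖p^k‖_K^{[K:ℚ_p]}·p^{−(f+m)} = p^{−kef−f−m}`);
* hence when `𝒪_K^×` has NO element of order `p` (`m = 0`; `torsionPExp_eq_zero_of_forall_pow_prime_eq_one`):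
  `{‖y‖ ≤ ‖ϖ‖^j} = p^k · log_p(𝒪_K^×)` forces **`j − 1 = k·e`**, so `e ∣ j − 1`
  (`dvd_of_closedBall_eq_zpow_smul_logUnits`) — the necessity half of abc-iut-w5-d180's tame criterion
  `e ∣ ord(t) − 1`, now WITHOUT the tameness hypothesis; in particular the unit ball `𝒪_K` (`j = 0`) is NO
  `p^k · log_p(𝒪_K^×)` as soon as `e ≥ 2` (`closedBall_one_ne_zpow_smul_logUnits_of_two_le`), and more generally
  no ball `t·𝒪_K` with `e ∤ ord(t) − 1` is (`closedBall_ne_zpow_smul_logUnits_of_not_dvd`);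
* in general (`m` arbitrary) the unit ball can only be a `p^k · log_p(𝒪_K^×)` if `m = f·(−k·e − 1)`, i.e.
  `f ∣ m` and `e ∣ m/f + 1` (`closedBall_one_ne_zpow_smul_logUnits_of_forall_torsionPExp_ne`), e.g. never when `f ∤ m`.

Classical local analysis (Neukirch, *Algebraic Number Theory*, Ch. II (5.5), (5.7); the volume of
`log_p(𝒪^×)` is [IUTchIV] Prop. 1.4 (ii), kernel-proved in `UnitLogVolume.lean`); nothing here bears on the
disputed [IUTchIII] Cor. 3.12 — the consumer `Summits/ABC/IUTFork/Thm311RealIsmDHMoverNoPTorsion.lean` draws the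
R-lane consequence and states the honest framing. [cite: NeukirchANT1999, Ch. II (5.5), (5.7)]
[cite: WeilBNT1967, Ch. II §2, Th. 1–2]
-/

noncomputable section

open MeasureTheory Set Metric
open scoped Pointwise
open Literature.NumberTheory.GaloisRepresentations.Ultrametric

namespace Literature.IUT.LogVolume

variable (p : ℕ) [Fact p.Prime]
variable (K : Type*) [NontriviallyNormedField K] [instK : NormedAlgebra ℚ_[p] K] [IsUltrametricDist K]
  [ProperSpace K]

/-! ## 1. Set algebra: `B(0,r) = p^k · A ↔ A = B(0, p^k r)` -/

omit [IsUltrametricDist K] [ProperSpace K] instK in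
/-- `‖(p^k)⁻¹‖ = p^k` in `ℚ_p`. [cite: NeukirchANT1999, Ch. II (5.5)] -/
theorem norm_inv_prime_zpow (k : ℤ) : ‖((p : ℚ_[p]) ^ k)⁻¹‖ = (p : ℝ) ^ k := by
  rw [norm_inv, norm_zpow, Padic.norm_p, inv_zpow', zpow_neg, inv_inv]

omit [IsUltrametricDist K] [ProperSpace K] in
/-- **Descaling**: a ball `{‖y‖ ≤ r}` equals `p^k · A` iff `A` is the ball `{‖y‖ ≤ p^k · r}`.
[cite: NeukirchANT1999, Ch. II (5.5)] -/
theorem closedBall_eq_zpow_smul_iff (r : ℝ) (k : ℤ) (A : Set K) :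
    closedBall (0 : K) r = ((p : ℚ_[p]) ^ k) • A ↔ A = closedBall (0 : K) ((p : ℝ) ^ k * r) := by
  have hp : p.Prime := Fact.out
  have hc : ((p : ℚ_[p]) ^ k) ≠ 0 := zpow_ne_zero _ (Nat.cast_ne_zero.2 hp.ne_zero)
  constructor
  · intro h
    rw [← inv_smul_smul₀ hc A, ← h, smul_closedBall' (inv_ne_zero hc), smul_zero, norm_inv_prime_zpow]
  · intro h
    rw [h, smul_closedBall' hc, smul_zero, norm_zpow, Padic.norm_p, inv_zpow', zpow_neg, ← mul_assoc,
      inv_mul_cancel₀ (zpow_ne_zero _ (by exact_mod_cast hp.ne_zero : (p : ℝ) ≠ 0)), one_mul]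

/-! ## 2. The volume constraint -/

/-- **`{‖y‖ ≤ ‖ϖ‖^j} = p^k · log_p(𝒪_K^×)` forces `m = f·(j − k·e − 1)`** (`p^m` = order of the `p`-primary
torsion of `𝒪_K^×`, `f` = residue degree, `e` = absolute ramification index): compare `μ_K({‖y‖ ≤ ‖ϖ‖^{j−ke}}) =
q^{−(j−ke)}` with `μ_K(log_p(𝒪_K^×)) = p^{−(f+m)}` ([IUTchIV] Prop. 1.4 (ii)). Valid at every `p`, every `e`.
[cite: NeukirchANT1999, Ch. II (5.5), (5.7)] -/
theorem torsionPExp_eq_of_closedBall_eq_zpow_smul_logUnits {ϖ : Kˣ} (hϖ : IsUniformizer ϖ) {j k : ℤ}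
    (h : closedBall (0 : K) (‖(ϖ : K)‖ ^ j) = ((p : ℚ_[p]) ^ k) • logUnits K) :
    (torsionPExp p K : ℤ) = residueDegree p K * (j - k * absRamificationIdx p K - 1) := by
  borelize K
  have hp : p.Prime := Fact.out
  have hp0 : (0 : ℝ) < p := by exact_mod_cast hp.pos
  have hp1 : (p : ℝ) ≠ 1 := by exact_mod_cast hp.one_lt.ne'
  have hϖ0 : ‖(ϖ : K)‖ ≠ 0 := norm_ne_zero_iff.2 ϖ.ne_zero
  -- `log_p(𝒪^×) = {‖y‖ ≤ ‖ϖ‖^(j - k e)}`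
  have hΛ : logUnits K = closedBall (0 : K) (‖(ϖ : K)‖ ^ (j - k * absRamificationIdx p K)) := by
    rw [(closedBall_eq_zpow_smul_iff p K _ k _).1 h]
    congr 1
    rw [zpow_sub₀ hϖ0, mul_comm k, zpow_mul, zpow_natCast, norm_pow_absRamificationIdx p K hϖ, inv_zpow',
      zpow_neg, div_inv_eq_mul, mul_comm]
  -- compare volumes
  have hvol := localVolume_real_logUnits_eq_inv_pow p K
  rw [hΛ, localVolume_real_closedBall_zpow K hϖ, residueCard_eq_pow p K] at hvol
  push_cast at hvol
  rw [← zpow_natCast, ← zpow_natCast, ← zpow_mul, ← zpow_neg] at hvol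
  have hexp := zpow_right_injective₀ hp0 hp1 hvol
  push_cast at hexp
  linarith

/-! ## 3. The torsion-free case `m = 0` -/

/-- If `K` contains no element `ζ ≠ 1` with `ζ^p = 1`, then `p ∤ #R^μ`, i.e. `m = 0`.
[cite: NeukirchANT1999, Ch. II (5.7)] -/
theorem torsionPExp_eq_zero_of_forall_pow_prime_eq_one (hζ : ∀ ζ : K, ζ ^ p = 1 → ζ = 1) :
    torsionPExp p K = 0 := by
  classical
  have hp : p.Prime := Fact.out
  haveI := finite_torsionUnits p K
  rw [torsionPExp, padicValNat.eq_zero_iff]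
  refine Or.inr (Or.inr ?_)
  intro hdvd
  obtain ⟨g, hg⟩ := exists_prime_orderOf_dvd_card' (G := torsionUnits K) p hdvd
  have hgp : ((g : Kˣ) : K) ^ p = 1 := by
    rw [← Units.val_pow_eq_pow_val, ← Subgroup.coe_pow, ← hg, pow_orderOf_eq_one, Subgroup.coe_one,
      Units.val_one]
  have h1 : ((g : Kˣ) : K) = 1 := hζ _ hgp
  have hg1 : g = 1 := Subtype.ext (Units.ext h1)
  rw [hg1, orderOf_one] at hg
  exact hp.one_lt.ne' hg.symm

/-- Conversely, `m = 0` means: `K` has no element `ζ ≠ 1` with `ζ^p = 1`. [cite: NeukirchANT1999, Ch. II (5.7)] -/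
theorem forall_pow_prime_eq_one_of_torsionPExp_eq_zero (hm : torsionPExp p K = 0) (ζ : K) (hζ : ζ ^ p = 1) :
    ζ = 1 := by
  classical
  have hp : p.Prime := Fact.out
  haveI := finite_torsionUnits p K
  by_contra hne
  have hζ0 : ζ ≠ 0 := by
    rintro rfl
    rw [zero_pow hp.ne_zero] at hζ
    exact zero_ne_one hζ
  set u : Kˣ := Units.mk0 ζ hζ0 with hu
  have hup : u ^ p = 1 := Units.ext (by rw [Units.val_pow_eq_pow_val]; exact hζ)
  have hu1 : u ≠ 1 := fun h => hne (by rw [← Units.val_mk0 hζ0, ← hu, h, Units.val_one])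
  have hord : orderOf u = p := orderOf_eq_prime hup hu1
  have hmem : u ∈ torsionUnits K := by
    change IsOfFinOrder u
    exact isOfFinOrder_iff_pow_eq_one.mpr ⟨p, hp.pos, hup⟩
  have hdvd : p ∣ Nat.card (torsionUnits K) := by
    rw [← hord, ← Subgroup.orderOf_mk u hmem]
    exact orderOf_dvd_natCard _
  rw [torsionPExp, padicValNat.eq_zero_iff] at hm
  rcases hm with h | h | h
  · exact hp.one_lt.ne' h
  · exact (Nat.card_pos (α := torsionUnits K)).ne' h
  · exact h hdvd

/-- **Torsion-free case**: if `p ∤ #R^μ` and `{‖y‖ ≤ ‖ϖ‖^j} = p^k · log_p(𝒪_K^×)`, then `j − 1 = k·e`.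
[cite: NeukirchANT1999, Ch. II (5.5), (5.7)] -/
theorem sub_one_eq_of_closedBall_eq_zpow_smul_logUnits (hm : torsionPExp p K = 0) {ϖ : Kˣ}
    (hϖ : IsUniformizer ϖ) {j k : ℤ} (h : closedBall (0 : K) (‖(ϖ : K)‖ ^ j) = ((p : ℚ_[p]) ^ k) • logUnits K) :
    j - 1 = k * absRamificationIdx p K := by
  have h1 := torsionPExp_eq_of_closedBall_eq_zpow_smul_logUnits p K hϖ h
  rw [hm] at h1
  have hf : (0 : ℤ) < residueDegree p K := by exact_mod_cast residueDegree_pos p K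
  have h2 : j - k * absRamificationIdx p K - 1 = 0 := by
    rcases mul_eq_zero.mp h1.symm with h | h
    · exact absurd h hf.ne'
    · exact h
  linarith

/-- **Torsion-free case, divisibility form**: `{‖y‖ ≤ ‖ϖ‖^j} = p^k · log_p(𝒪_K^×)` ⇒ `e ∣ j − 1` — the
necessity half of the tame criterion of `Thm311RealIsmDHMoverCriterion` (`e ≤ p − 2`), freed of tameness.
[cite: NeukirchANT1999, Ch. II (5.5), (5.7)] -/
theorem dvd_of_closedBall_eq_zpow_smul_logUnits (hm : torsionPExp p K = 0) {ϖ : Kˣ} (hϖ : IsUniformizer ϖ)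
    {j k : ℤ} (h : closedBall (0 : K) (‖(ϖ : K)‖ ^ j) = ((p : ℚ_[p]) ^ k) • logUnits K) :
    ((absRamificationIdx p K : ℕ) : ℤ) ∣ j - 1 :=
  ⟨k, by rw [sub_one_eq_of_closedBall_eq_zpow_smul_logUnits p K hm hϖ h, mul_comm]⟩

/-- **No ball `t·𝒪_K` with `e ∤ ord(t) − 1` is a `p^k · log_p(𝒪_K^×)`** when `p ∤ #R^μ` (any `p`, any `e`).
[cite: NeukirchANT1999, Ch. II (5.5), (5.7)] -/
theorem closedBall_ne_zpow_smul_logUnits_of_not_dvd (hm : torsionPExp p K = 0) {ϖ : Kˣ}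
    (hϖ : IsUniformizer ϖ) {t : K} {j : ℤ} (ht : ‖t‖ = ‖(ϖ : K)‖ ^ j)
    (hj : ¬ ((absRamificationIdx p K : ℕ) : ℤ) ∣ j - 1) (k : ℤ) :
    closedBall (0 : K) ‖t‖ ≠ ((p : ℚ_[p]) ^ k) • logUnits K := by
  rw [ht]
  exact fun h => hj (dvd_of_closedBall_eq_zpow_smul_logUnits p K hm hϖ h)

/-- **The unit ball `𝒪_K` is no `p^k · log_p(𝒪_K^×)` when `p ∤ #R^μ` and `e ≥ 2`** (`j = 0`: `e ∣ −1` is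
impossible). No tameness or parity hypothesis: every ramified `K/ℚ_p` without a primitive `p`-th root of unity.
[cite: NeukirchANT1999, Ch. II (5.5), (5.7)] -/
theorem closedBall_one_ne_zpow_smul_logUnits_of_two_le (hm : torsionPExp p K = 0)
    (he : 2 ≤ absRamificationIdx p K) (k : ℤ) :
    closedBall (0 : K) 1 ≠ ((p : ℚ_[p]) ^ k) • logUnits K := by
  obtain ⟨ϖ, hϖ⟩ := exists_isUniformizer (F := K)
  have h1 : (1 : ℝ) = ‖(ϖ : K)‖ ^ (0 : ℤ) := (zpow_zero _).symm
  rw [h1]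
  intro h
  have h2 := dvd_of_closedBall_eq_zpow_smul_logUnits p K hm hϖ h
  rw [zero_sub, dvd_neg] at h2
  have h3 := Int.eq_one_of_dvd_one (by positivity) h2
  omega

/-- The same with the hypothesis «no `ζ ≠ 1` with `ζ^p = 1` in `K`» in place of `m = 0`.
[cite: NeukirchANT1999, Ch. II (5.5), (5.7)] -/
theorem closedBall_one_ne_zpow_smul_logUnits_of_forall_pow_prime_eq_one (hζ : ∀ ζ : K, ζ ^ p = 1 → ζ = 1)
    (he : 2 ≤ absRamificationIdx p K) (k : ℤ) :
    closedBall (0 : K) 1 ≠ ((p : ℚ_[p]) ^ k) • logUnits K :=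
  closedBall_one_ne_zpow_smul_logUnits_of_two_le p K (torsionPExp_eq_zero_of_forall_pow_prime_eq_one p K hζ) he k

/-- **Unramified converse shape**: when `p ∤ #R^μ`, the unit ball can only be `p^k · log_p(𝒪_K^×)` with
`k = −1` and `e = 1` (then indeed `log_p(𝒪_K^×) = p·𝒪_K` for odd `p`, [IUTchIV] Prop. 1.2 (i)).
[cite: NeukirchANT1999, Ch. II (5.5)] -/
theorem absRamificationIdx_eq_one_of_closedBall_one_eq_zpow_smul_logUnits (hm : torsionPExp p K = 0) {k : ℤ}
    (h : closedBall (0 : K) 1 = ((p : ℚ_[p]) ^ k) • logUnits K) :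
    absRamificationIdx p K = 1 ∧ k = -1 := by
  obtain ⟨ϖ, hϖ⟩ := exists_isUniformizer (F := K)
  have h1 : (1 : ℝ) = ‖(ϖ : K)‖ ^ (0 : ℤ) := (zpow_zero _).symm
  rw [h1] at h
  have h2 := sub_one_eq_of_closedBall_eq_zpow_smul_logUnits p K hm hϖ h
  have he : (1 : ℤ) ≤ absRamificationIdx p K := by exact_mod_cast absRamificationIdx_pos p K
  rw [zero_sub] at h2
  -- `-1 = k * e` with `e ≥ 1`
  have hk : k = -1 := by
    rcases lt_trichotomy k (-1) with hlt | heq | hgt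
    · nlinarith
    · exact heq
    · nlinarith
  subst hk
  constructor
  · have : ((absRamificationIdx p K : ℕ) : ℤ) = 1 := by linarith
    exact_mod_cast this
  · rfl

/-! ## 4. General `m`: the arithmetic of the exceptional places -/

/-- **General torsion**: the unit ball `𝒪_K` can be a `p^k · log_p(𝒪_K^×)` only if `m = f·(−k·e − 1)` (so
`f ∣ m`, `e ∣ m/f + 1`, `k = −(m/f + 1)/e`). [cite: NeukirchANT1999, Ch. II (5.5), (5.7)] -/
theorem torsionPExp_eq_of_closedBall_one_eq_zpow_smul_logUnits {k : ℤ}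
    (h : closedBall (0 : K) 1 = ((p : ℚ_[p]) ^ k) • logUnits K) :
    (torsionPExp p K : ℤ) = residueDegree p K * (-(k * absRamificationIdx p K) - 1) := by
  obtain ⟨ϖ, hϖ⟩ := exists_isUniformizer (F := K)
  have h1 : (1 : ℝ) = ‖(ϖ : K)‖ ^ (0 : ℤ) := (zpow_zero _).symm
  rw [h1] at h
  have h2 := torsionPExp_eq_of_closedBall_eq_zpow_smul_logUnits p K hϖ h
  rw [h2]
  ring

/-- **Mover form for general torsion**: if NO `k ∈ ℤ` satisfies `m = f·(−k·e − 1)` (e.g. `f ∤ m`, or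
`e ∤ m/f + 1`), the unit ball is no `p^k · log_p(𝒪_K^×)`. [cite: NeukirchANT1999, Ch. II (5.5), (5.7)] -/
theorem closedBall_one_ne_zpow_smul_logUnits_of_forall_torsionPExp_ne
    (hne : ∀ k : ℤ, (torsionPExp p K : ℤ) ≠ residueDegree p K * (-(k * absRamificationIdx p K) - 1))
    (k : ℤ) : closedBall (0 : K) 1 ≠ ((p : ℚ_[p]) ^ k) • logUnits K :=
  fun h => hne k (torsionPExp_eq_of_closedBall_one_eq_zpow_smul_logUnits p K h)

/-- **`f ∤ m` ⇒ the unit ball is no `p^k · log_p(𝒪_K^×)`** (the simplest instance of the general constraint).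
[cite: NeukirchANT1999, Ch. II (5.5), (5.7)] -/
theorem closedBall_one_ne_zpow_smul_logUnits_of_not_dvd (hf : ¬ residueDegree p K ∣ torsionPExp p K) (k : ℤ) :
    closedBall (0 : K) 1 ≠ ((p : ℚ_[p]) ^ k) • logUnits K := by
  refine closedBall_one_ne_zpow_smul_logUnits_of_forall_torsionPExp_ne p K (fun k' h => hf ?_) k
  have h' : ((residueDegree p K : ℕ) : ℤ) ∣ (torsionPExp p K : ℤ) := ⟨_, h⟩
  exact_mod_cast h'

/-! ## 5. A sufficient condition for `m = 0`: a primitive `p`-th root of unity forces `(p − 1) ∣ e` -/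

omit instK [ProperSpace K] in
/-- Two primitive `p`-th roots of unity `ζ`, `μ` of `K` have `‖1 − μ‖ = ‖1 − ζ‖` (each is a power of the other,
`‖1 − ζⁱ‖ ≤ ‖1 − ζ‖`). [cite: NeukirchANT1999, Ch. II (7.13)] -/
theorem norm_one_sub_eq_of_isPrimitiveRoot {ζ μ : K} (hζ : IsPrimitiveRoot ζ p) (hμ : IsPrimitiveRoot μ p) :
    ‖1 - μ‖ = ‖1 - ζ‖ := by
  have hp : p.Prime := Fact.out
  have hn1 : ∀ {x : K}, x ^ p = 1 → ‖x‖ ≤ 1 := fun {x} hx => by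
    have h : ‖x‖ ^ p = 1 := by rw [← norm_pow, hx, norm_one]
    exact ((pow_eq_one_iff_of_nonneg (norm_nonneg x) hp.ne_zero).1 h).le
  have hζ1 : ‖ζ‖ ≤ 1 := hn1 hζ.pow_eq_one
  obtain ⟨i, -, rfl⟩ := hζ.eq_pow_of_pow_eq_one hμ.pow_eq_one
  refine le_antisymm (norm_one_sub_pow_le K hζ1 i) ?_
  obtain ⟨i', -, hi'⟩ := hμ.eq_pow_of_pow_eq_one hζ.pow_eq_one
  calc ‖1 - ζ‖ = ‖1 - (ζ ^ i) ^ i'‖ := by rw [hi']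
    _ ≤ ‖1 - ζ ^ i‖ := norm_one_sub_pow_le K (hn1 hμ.pow_eq_one) i'

omit instK [ProperSpace K] in
/-- **`‖1 − ζ‖^{p−1} = ‖p‖` for a primitive `p`-th root of unity `ζ ∈ K`**: evaluate
`Φ_p(X) = ∏_{μ primitive} (X − μ)` at `1` (`Φ_p(1) = p`) and take norms. [cite: NeukirchANT1999, Ch. II (7.13)] -/
theorem norm_one_sub_pow_eq_norm_prime_of_isPrimitiveRoot {ζ : K} (hζ : IsPrimitiveRoot ζ p) :
    ‖1 - ζ‖ ^ (p - 1) = ‖(p : K)‖ := by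
  classical
  have hp : p.Prime := Fact.out
  have h1 : Polynomial.eval 1 (Polynomial.cyclotomic p K) = (p : K) := Polynomial.eval_one_cyclotomic_prime
  rw [Polynomial.cyclotomic_eq_prod_X_sub_primitiveRoots hζ, Polynomial.eval_prod] at h1
  simp only [Polynomial.eval_sub, Polynomial.eval_X, Polynomial.eval_C] at h1
  rw [← h1, norm_prod, Finset.prod_congr rfl fun μ hμ =>
    norm_one_sub_eq_of_isPrimitiveRoot p K hζ ((mem_primitiveRoots hp.pos).1 hμ), Finset.prod_const,
    hζ.card_primitiveRoots, Nat.totient_prime hp]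

/-- **A primitive `p`-th root of unity in `K` forces `(p − 1) ∣ e(K/ℚ_p)`** (`‖1 − ζ‖ = ‖ϖ‖^a` and
`‖1 − ζ‖^{p−1} = ‖p‖ = ‖ϖ‖^e` give `a·(p − 1) = e`; i.e. `K ⊇ ℚ_p(ζ_p)`, totally ramified of degree `p − 1`).
[cite: NeukirchANT1999, Ch. II (7.13)] -/
theorem pred_dvd_absRamificationIdx_of_isPrimitiveRoot {ζ : K} (hζ : IsPrimitiveRoot ζ p) :
    (p - 1) ∣ absRamificationIdx p K := by
  have hp : p.Prime := Fact.out
  obtain ⟨ϖ, hϖ⟩ := exists_isUniformizer (F := K)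
  have hζ1 : (1 : K) - ζ ≠ 0 := sub_ne_zero.2 (hζ.ne_one hp.one_lt).symm
  obtain ⟨a, ha⟩ := hϖ.2 (Units.mk0 (1 - ζ) hζ1)
  rw [Units.val_mk0] at ha
  have h := norm_one_sub_pow_eq_norm_prime_of_isPrimitiveRoot p K hζ
  rw [ha, norm_prime_eq_norm_pow p K hϖ, ← zpow_natCast, ← zpow_mul, ← zpow_natCast] at h
  have h' : a * ((p - 1 : ℕ) : ℤ) = (absRamificationIdx p K : ℤ) := hϖ.zpow_injective h
  exact Int.natCast_dvd_natCast.1 ⟨a, by rw [← h', mul_comm]⟩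

/-- **`(p − 1) ∤ e(K/ℚ_p)` ⇒ `K` has no `ζ ≠ 1` with `ζ^p = 1`** (e.g. `p` odd and `e` odd ≥ 3, or any `e`
with `p − 1 ∤ e`; vacuous for `p = 2`). [cite: NeukirchANT1999, Ch. II (7.13)] -/
theorem forall_pow_prime_eq_one_of_not_pred_dvd (h : ¬ (p - 1) ∣ absRamificationIdx p K) (ζ : K)
    (hζ : ζ ^ p = 1) : ζ = 1 := by
  by_contra hne
  have hord : orderOf ζ = p := orderOf_eq_prime hζ hne
  exact h (pred_dvd_absRamificationIdx_of_isPrimitiveRoot p K (hord ▸ IsPrimitiveRoot.orderOf ζ))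

/-- `(p − 1) ∤ e(K/ℚ_p)` ⇒ `p ∤ #R^μ` (`m = 0`). [cite: NeukirchANT1999, Ch. II (5.7), (7.13)] -/
theorem torsionPExp_eq_zero_of_not_pred_dvd (h : ¬ (p - 1) ∣ absRamificationIdx p K) : torsionPExp p K = 0 :=
  torsionPExp_eq_zero_of_forall_pow_prime_eq_one p K (forall_pow_prime_eq_one_of_not_pred_dvd p K h)

/-- **Arithmetic form of the unit-ball constraint**: `(p − 1) ∤ e` and `e ≥ 2` ⇒ the unit ball `𝒪_K` is no
`p^k · log_p(𝒪_K^×)` (`p` odd: every `e ≥ 2` not divisible by `p − 1`, tame or wild).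
[cite: NeukirchANT1999, Ch. II (5.5), (5.7), (7.13)] -/
theorem closedBall_one_ne_zpow_smul_logUnits_of_not_pred_dvd (h : ¬ (p - 1) ∣ absRamificationIdx p K)
    (he : 2 ≤ absRamificationIdx p K) (k : ℤ) :
    closedBall (0 : K) 1 ≠ ((p : ℚ_[p]) ^ k) • logUnits K :=
  closedBall_one_ne_zpow_smul_logUnits_of_two_le p K (torsionPExp_eq_zero_of_not_pred_dvd p K h) he k

/-- **Arithmetic form, general ball**: `(p − 1) ∤ e`, `‖t‖ = ‖ϖ‖^j`, `e ∤ j − 1` ⇒ `t·𝒪_K` is no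
`p^k · log_p(𝒪_K^×)`. [cite: NeukirchANT1999, Ch. II (5.5), (5.7), (7.13)] -/
theorem closedBall_ne_zpow_smul_logUnits_of_not_pred_dvd (h : ¬ (p - 1) ∣ absRamificationIdx p K) {ϖ : Kˣ}
    (hϖ : IsUniformizer ϖ) {t : K} {j : ℤ} (ht : ‖t‖ = ‖(ϖ : K)‖ ^ j)
    (hj : ¬ ((absRamificationIdx p K : ℕ) : ℤ) ∣ j - 1) (k : ℤ) :
    closedBall (0 : K) ‖t‖ ≠ ((p : ℚ_[p]) ^ k) • logUnits K :=
  closedBall_ne_zpow_smul_logUnits_of_not_dvd p K (torsionPExp_eq_zero_of_not_pred_dvd p K h) hϖ ht hj k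

end Literature.IUT.LogVolume

end
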